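import Mathlib.Data.Fintype.Card
import Mathlib.Data.Fintype.Sigma
import Mathlib.Logic.Equiv.Fintype
import HarnessLib

/-!
# Matching term maps with equal fibre sizes (re-indexing lemmas for the laser-method recursion) — proved

Topic `Literature/Computability/AlgebraicComplexity`.  In the recursion of the asymmetric laser
method (Vassilevska Williams–Xu–Xu–Zhou 2024, §8, "Procedure of Degeneration") the output of one stage
— an interface tensor with SOME listing of its chunks and terms — is the input of the next stage,
which lists the same chunks and terms in its own order; interface tensors are invariant under such
re-indexings (`InterfaceTermSplit.interfaceTensor_reindex`: a bijection `φ` of chunks and `ψ` of terms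
with `τ ∘ φ = ψ ∘ τ'` and `L' = L ∘ ψ`).  Because the tree's term splittings enumerate subtypes by
`Fintype.equivFin` (an unspecified order), the re-indexings have to be produced EXISTENTIALLY from
counting data.  This file provides that folklore combinatorics:

* `apply_ofFiberEquiv_symm` — maps `f : α → T`, `g : β → T` with fibres of equal size are conjugate
  by Mathlib's `Equiv.ofFiberEquiv` at the fibrewise bijections `Fintype.equivOfCardEq` (the inverse
  direction of `Equiv.ofFiberEquiv_map`);
* `exists_termMatching` — for term maps `τ : κ_A → ι_A`, `τ' : κ_B → ι_B` and "records" `rec, rec'`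
  of the terms in a common type: if for every pair (record, fibre size) both sides have the same
  number of terms with that record and that many chunks, then there are `ψ : ι_B ≃ ι_A` and
  `φ : κ_B ≃ κ_A` with `rec ∘ ψ = rec'` and `τ ∘ φ = ψ ∘ τ'` (exactly the hypotheses `φ, ψ, hτ, hL` of
  `ConstituentRegion.vxxz2024_level_step` when the parameter lists factor through the records);
* `termMatchingCheck` — the counting hypothesis as a finite conjunction over the two index types
  (`exists_termMatching_of_check`), decidable when the records have decidable equality (rational
  mirrors of the parameter lists).

Everything is proved; the definitions are the key of a term and the finite check (with its `Decidable` instance).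

## References

* V. Vassilevska Williams, Y. Xu, Z. Xu, R. Zhou, *New bounds for matrix multiplication: from alpha
  to omega*, SODA 2024, arXiv:2307.07970, Def. 4.1 (interface tensors do not depend on the order of
  the parameter list) and §8 (Procedure of Degeneration). [VassilevskaWilliamsXuXuZhou2024]
-/

noncomputable section

namespace Literature.Computability.AlgebraicComplexity

/-! ## Maps with fibres of equal size -/

section Fibre

variable {α β T : Type*} [Fintype α] [Fintype β] [DecidableEq T] (f : α → T) (g : β → T)

/-- Maps with fibres of equal size are conjugate by an equivalence of their domains: Mathlib's
`Equiv.ofFiberEquiv` at the fibrewise bijections `Fintype.equivOfCardEq`; this is the inverse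
direction of `Equiv.ofFiberEquiv_map`. [folklore] -/
theorem apply_ofFiberEquiv_symm (h : ∀ t, Fintype.card {a // f a = t} = Fintype.card {b // g b = t}) (b : β) :
    f ((Equiv.ofFiberEquiv (f := f) (g := g) fun t => Fintype.equivOfCardEq (h t)).symm b) = g b := by
  have := Equiv.ofFiberEquiv_map (f := f) (g := g) (fun t => Fintype.equivOfCardEq (h t))
    ((Equiv.ofFiberEquiv (f := f) (g := g) fun t => Fintype.equivOfCardEq (h t)).symm b)
  rw [Equiv.apply_symm_apply] at this
  exact this.symm

end Fibre

/-! ## Matching two term maps through records -/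

section Terms

variable {ιA ιB κA κB R : Type*} [Fintype ιA] [Fintype ιB] [Fintype κA] [Fintype κB]
  [DecidableEq ιA] [DecidableEq ιB]

/-- The key of a term: its record and its number of chunks. [folklore] -/
def termKey (τ : κA → ιA) (rec : ιA → R) (a : ιA) : R × ℕ := (rec a, Fintype.card {u // τ u = a})

/-- **Existence of a matching of terms and chunks.**  If for every key (record, number of chunks)
both sides have equally many terms with that key, there are bijections `ψ` of terms and `φ` of chunks
with `rec ∘ ψ = rec'` and `τ ∘ φ = ψ ∘ τ'`. [folklore] -/
theorem exists_termMatching [DecidableEq R] (τ : κA → ιA) (τ' : κB → ιB) (rec : ιA → R) (rec' : ιB → R)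
    (h : ∀ p : R × ℕ, Fintype.card {a // termKey τ rec a = p} = Fintype.card {b // termKey τ' rec' b = p}) :
    ∃ (ψ : ιB ≃ ιA) (φ : κB ≃ κA), (∀ b, rec (ψ b) = rec' b) ∧ ∀ u', τ (φ u') = ψ (τ' u') := by
  classical
  -- match the terms through their keys
  set ψ : ιB ≃ ιA := (Equiv.ofFiberEquiv (f := termKey τ rec) (g := termKey τ' rec') fun p => Fintype.equivOfCardEq (h p)).symm
    with hψdef
  have hψ : ∀ b, termKey τ rec (ψ b) = termKey τ' rec' b := fun b =>
    apply_ofFiberEquiv_symm (termKey τ rec) (termKey τ' rec') h b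
  -- match the chunks fibrewise: the fibre of `ψ ∘ τ'` over `a` is the fibre of `τ'` over `ψ⁻¹ a`
  have hcard : ∀ a, Fintype.card {u // τ u = a} = Fintype.card {u' // ψ (τ' u') = a} := by
    intro a
    have e1 : Fintype.card {u' // ψ (τ' u') = a} = Fintype.card {u' // τ' u' = ψ.symm a} :=
      Fintype.card_congr (Equiv.subtypeEquivRight fun u' => by rw [Equiv.eq_symm_apply])
    have e2 := congrArg Prod.snd (hψ (ψ.symm a))
    simp only [termKey, Equiv.apply_symm_apply] at e2
    rw [e1, e2]
  refine ⟨ψ, (Equiv.ofFiberEquiv (f := τ) (g := fun u' => ψ (τ' u')) fun a => Fintype.equivOfCardEq (hcard a)).symm,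
    fun b => congrArg Prod.fst (hψ b), fun u' => ?_⟩
  exact apply_ofFiberEquiv_symm τ (fun u' => ψ (τ' u')) hcard u'

/-- **The counting hypothesis as a finite check**: it suffices to compare the two counts at the keys
that occur (elsewhere both vanish). [folklore] -/
def termMatchingCheck [DecidableEq R] (τ : κA → ιA) (τ' : κB → ιB) (rec : ιA → R) (rec' : ιB → R) : Prop :=
  (∀ a, Fintype.card {a' // termKey τ rec a' = termKey τ rec a} = Fintype.card {b // termKey τ' rec' b = termKey τ rec a}) ∧
    ∀ b, Fintype.card {a // termKey τ rec a = termKey τ' rec' b} = Fintype.card {b' // termKey τ' rec' b' = termKey τ' rec' b}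

/-- The finite check is decidable when the records have decidable equality. [folklore] -/
instance termMatchingCheck.decidable [DecidableEq R] (τ : κA → ιA) (τ' : κB → ιB) (rec : ιA → R) (rec' : ιB → R) :
    Decidable (termMatchingCheck τ τ' rec rec') := by
  unfold termMatchingCheck; infer_instance

/-- The finite check implies the counting hypothesis at every key. [folklore] -/
theorem card_eq_of_termMatchingCheck [DecidableEq R] {τ : κA → ιA} {τ' : κB → ιB} {rec : ιA → R} {rec' : ιB → R}
    (h : termMatchingCheck τ τ' rec rec') (p : R × ℕ) :
    Fintype.card {a // termKey τ rec a = p} = Fintype.card {b // termKey τ' rec' b = p} := by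
  classical
  by_cases hA : ∃ a, termKey τ rec a = p
  · obtain ⟨a, rfl⟩ := hA; exact h.1 a
  by_cases hB : ∃ b, termKey τ' rec' b = p
  · obtain ⟨b, rfl⟩ := hB; exact h.2 b
  push Not at hA hB
  rw [Fintype.card_eq_zero_iff.2 ⟨fun x => hA x.1 x.2⟩, Fintype.card_eq_zero_iff.2 ⟨fun x => hB x.1 x.2⟩]

/-- **Matching from the finite check.** [folklore] -/
theorem exists_termMatching_of_check [DecidableEq R] {τ : κA → ιA} {τ' : κB → ιB} {rec : ιA → R} {rec' : ιB → R}
    (h : termMatchingCheck τ τ' rec rec') :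
    ∃ (ψ : ιB ≃ ιA) (φ : κB ≃ κA), (∀ b, rec (ψ b) = rec' b) ∧ ∀ u', τ (φ u') = ψ (τ' u') :=
  exists_termMatching τ τ' rec rec' (card_eq_of_termMatchingCheck h)

end Terms

end Literature.Computability.AlgebraicComplexity
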